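import Mathlib
import Summits.ResolutionOfSingularities.ResolutionOfSingularities.Theorems.RadicialJungCleanModelsContactChainPresentation
import HarnessLib

/-!
# Route `RadicialJung`, crux `CleanModels` (stmt-ResolutionOfSingularities-15917), line `Sketch` rev 35, stub 6 `stub_cleanProp44` (X44c),
# work plan O8 / L7b FROM THE HYPOTHESIS OF X44c: `CleanRegAt` at a point of the curve ⟹ exit by point blow-ups, or the uncharged configuration

Memo `Cruxes/CleanModels/Lines/Sketch-memo-hand2-g8-stubs-5-7.md` §2.  X44c assumes `CleanRegAt p (toFunctionField x) (ρ^♯G₀)` at EVERY point of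
a clean stage; at a closed point `x₀` of a regular curve `C₀` to be blown up this file turns that hypothesis into the L7b conclusion:

* `isRsopPart_singleton_of_not_mem_sq` — an element of `𝔪 ∖ 𝔪²` of a regular local ring is part of a regular system of parameters
  (Matsumura 14.2, through the tree's `quotient_span_singleton` and `IsRsopPart.of_isRegularLocalRing_quotient`).
* `rep_shift_sub_pow` — the representative shift `G ↦ G − c^p` inside the `F^p`-line (characteristic `p`): from `Σ c_j^p G^j = f s` to a
  non-trivial representative equal to `f (s − c^p)`.
* `exists_pointChain_cleanPermissibleAt_or_uncharged_of_cleanRegAt` — **L7b from `CleanRegAt`**: for `X₀` regular integral locally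
  Noetherian with `char K(X₀) = p`, `C₀` a regular curve, `x₀ ∈ C₀` closed with `dim 𝒪_{X₀,x₀} = 3`, `w` transversal: EITHER there is a
  dominant chain of point blowing ups following `C₀` at whose end point (closed, over `x₀`) the line of `σ^♯G` is clean-permissible for the strict
  transform (loose clean form (2): length `0`, ✓ `cleanPermissibleAt_of_unit`; form (3): the shifted representative is a regular parameter,
  inside `𝓘_{C₀,x₀}` or transversal; form (1): ✓ `exists_pointChain_cleanPermissibleAt_or_uncharged_of_looseCleanForm`), OR the line has a
  representative `u · ∏ s_i^{a_i}` (`s` part of a regular system of parameters, all `a_i` prime to `p`) all of whose members are transversal to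
  the curve, `s_i = γ_i w^{k_i} + π_i`, with `p ∣ Σ k_i a_i` — the UNCHARGED configuration, whose treatment is the memo's (T1)/(T2a ✓ p812527)/(T2b).

Honest framing: OURS; nothing here proves resolution in characteristic `p`, X44c, or any case of `CleanModels`.
-/

noncomputable section

set_option linter.dupNamespace false -- mandated namespace of this single-conjunct summit

open CategoryTheory AlgebraicGeometry TopologicalSpace IsLocalRing
open Literature.AlgebraicGeometry.Resolution Literature.AlgebraicGeometry.Motives
open Scheme.IdealSheafData

universe u

namespace Summit.ResolutionOfSingularities.ResolutionOfSingularities.Theorems.RadicialJung.CleanModels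

/-- **Matsumura 14.2, one element**: `r ∈ 𝔪 ∖ 𝔪²` of a regular local ring is part of a regular system of parameters. [cite: Matsumura1987, Thm. 14.2] -/
theorem isRsopPart_singleton_of_not_mem_sq {A : Type u} [CommRing A] [IsRegularLocalRing A] {r : A} (hr : r ∈ maximalIdeal A)
    (hr2 : r ∉ maximalIdeal A ^ 2) : IsRsopPart ![r] := by
  have hrange : Set.range ![r] = {r} := by
    ext y; simp [eq_comm]
  obtain ⟨hreg, hdim⟩ := quotient_span_singleton A hr hr2
  haveI : IsRegularLocalRing (A ⧸ Ideal.span (Set.range ![r])) := by rw [hrange]; exact hreg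
  refine IsRsopPart.of_isRegularLocalRing_quotient (fun i => by fin_cases i; simpa using hr) ?_
  rw [hrange, Nat.cast_one, hdim]

/-- **The representative shift `G ↦ G − c^p`** inside the `F^p`-line in characteristic `p`. [folklore] -/
theorem rep_shift_sub_pow {R F : Type u} [CommRing R] [Field F] (p : ℕ) [hp : Fact p.Prime] [CharP F p] (f : R →+* F) (G : F)
    (cc : Fin p → F) (hcc : ∃ j : Fin p, (j : ℕ) ≠ 0 ∧ cc j ≠ 0) (s c : R) (hX : (∑ j : Fin p, cc j ^ p * G ^ (j : ℕ)) = f s) :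
    ∃ cc' : Fin p → F, (∃ j : Fin p, (j : ℕ) ≠ 0 ∧ cc' j ≠ 0) ∧ (∑ j : Fin p, cc' j ^ p * G ^ (j : ℕ)) = f (s - c ^ p) := by
  classical
  let z : Fin p := ⟨0, hp.out.pos⟩
  refine ⟨Function.update cc z (cc z - f c), ?_, ?_⟩
  · obtain ⟨j, hj, hj0⟩ := hcc
    refine ⟨j, hj, ?_⟩
    have hjz : j ≠ z := fun h => hj (by rw [h])
    rw [Function.update_of_ne hjz]
    exact hj0
  · have hsplit : ∀ g : Fin p → F, (∑ j : Fin p, g j ^ p * G ^ (j : ℕ)) =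
        g z ^ p * G ^ (z : ℕ) + ∑ j ∈ Finset.univ.erase z, g j ^ p * G ^ (j : ℕ) := fun g =>
      (Finset.add_sum_erase _ _ (Finset.mem_univ z)).symm
    rw [hsplit] at hX ⊢
    have hrest : (∑ j ∈ Finset.univ.erase z, Function.update cc z (cc z - f c) j ^ p * G ^ (j : ℕ)) =
        ∑ j ∈ Finset.univ.erase z, cc j ^ p * G ^ (j : ℕ) :=
      Finset.sum_congr rfl fun j hj => by rw [Function.update_of_ne (Finset.ne_of_mem_erase hj)]
    rw [hrest, Function.update_self, sub_pow_char, map_sub, map_pow, ← hX]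
    have hz0 : ((z : ℕ)) = 0 := rfl
    rw [hz0, pow_zero, mul_one, mul_one]
    ring

/-- **L7b from `CleanRegAt`.**  See the module docstring. [cite: CossartJannsenSaito2020, proof of Thm. 6.28, Step 5]
[cite: CossartPiltant2008, Prop. 4.4 (proof, p. 10)] [cite: Piltant2013, §2 Axiom 4] -/
theorem exists_pointChain_cleanPermissibleAt_or_uncharged_of_cleanRegAt {X₀ : Scheme.{u}} [IsIntegral X₀] [IsLocallyNoetherian X₀]
    (hX₀ : Scheme.IsRegular X₀) (p : ℕ) [Fact p.Prime] [CharP X₀.functionField p] {C₀ : Closeds X₀}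
    (hC₀reg : ∀ y ∈ (C₀ : Set X₀), ∃ c : Fin 2 → X₀.presheaf.stalk y,
      IsRsopPart c ∧ Ideal.span (Set.range c) = stalkIdeal (vanishingIdeal C₀) y)
    {x₀ : X₀} (hx₀ : IsClosed ({x₀} : Set X₀)) (hx₀C : x₀ ∈ (C₀ : Set X₀)) (hdim₀ : ringKrullDim (X₀.presheaf.stalk x₀) = 3)
    (w : X₀.presheaf.stalk x₀) (hw : stalkIdeal (vanishingIdeal C₀) x₀ ⊔ Ideal.span {w} = maximalIdeal _)
    (G : X₀.functionField) (hG : CleanRegAt p (RatFn.toFunctionField x₀) G) :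
    (∃ (X : Scheme.{u}) (_ : IsIntegral X) (_ : IsLocallyNoetherian X) (σ : X ⟶ X₀) (_ : IsDominant σ) (C : Closeds X) (x : X)
        (n : ℕ), IsPointChainAlong σ C₀ C x n ∧ σ x = x₀ ∧ IsClosed ({x} : Set X) ∧
        CleanPermissibleAt p (RatFn.toFunctionField x) (RatFn.functionFieldMap σ G) (stalkIdeal (vanishingIdeal C) x)) ∨
      ∃ (cc : Fin p → X₀.functionField) (m : ℕ) (s : Fin m → X₀.presheaf.stalk x₀) (a : Fin m → ℕ) (u : X₀.presheaf.stalk x₀)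
        (γ π : Fin m → X₀.presheaf.stalk x₀) (k : Fin m → ℕ),
        (∃ j : Fin p, (j : ℕ) ≠ 0 ∧ cc j ≠ 0) ∧ IsRsopPart s ∧ (∀ i, ¬ p ∣ a i) ∧ IsUnit u ∧
        (∑ j : Fin p, cc j ^ p * G ^ (j : ℕ)) = RatFn.toFunctionField x₀ (u * ∏ i, s i ^ a i) ∧
        (∀ i, s i ∉ stalkIdeal (vanishingIdeal C₀) x₀) ∧ (∀ i, IsUnit (γ i)) ∧
        (∀ i, π i ∈ stalkIdeal (vanishingIdeal C₀) x₀) ∧ (∀ i, s i = γ i * w ^ k i + π i) ∧ p ∣ ∑ i, k i * a i := by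
  classical
  haveI : IsRegularLocalRing (X₀.presheaf.stalk x₀) := hX₀ x₀
  obtain ⟨c2, hc2, hc2P⟩ := hC₀reg x₀ hx₀C
  haveI : IsRegularLocalRing (X₀.presheaf.stalk x₀ ⧸ stalkIdeal (vanishingIdeal C₀) x₀) := by
    rw [← hc2P]; exact hc2.isRegularLocalRing_quotient
  obtain ⟨hregx, cc, hcc, hform⟩ := hG
  -- a wrapper turning the `looseCleanForm` dichotomy into ours
  have wrap : ∀ (cc : Fin p → X₀.functionField) (_ : ∃ j : Fin p, (j : ℕ) ≠ 0 ∧ cc j ≠ 0) {m : ℕ}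
      (s : Fin m → X₀.presheaf.stalk x₀) (_ : IsRsopPart s) (a : Fin m → ℕ) (_ : ∀ i, ¬ p ∣ a i) (u : X₀.presheaf.stalk x₀)
      (_ : IsUnit u) (_ : (∑ j : Fin p, cc j ^ p * G ^ (j : ℕ)) = RatFn.toFunctionField x₀ (u * ∏ i, s i ^ a i)),
      (∃ (X : Scheme.{u}) (_ : IsIntegral X) (_ : IsLocallyNoetherian X) (σ : X ⟶ X₀) (_ : IsDominant σ) (C : Closeds X) (x : X)
          (n : ℕ), IsPointChainAlong σ C₀ C x n ∧ σ x = x₀ ∧ IsClosed ({x} : Set X) ∧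
          CleanPermissibleAt p (RatFn.toFunctionField x) (RatFn.functionFieldMap σ G) (stalkIdeal (vanishingIdeal C) x)) ∨
        ∃ (cc : Fin p → X₀.functionField) (m : ℕ) (s : Fin m → X₀.presheaf.stalk x₀) (a : Fin m → ℕ) (u : X₀.presheaf.stalk x₀)
          (γ π : Fin m → X₀.presheaf.stalk x₀) (k : Fin m → ℕ),
          (∃ j : Fin p, (j : ℕ) ≠ 0 ∧ cc j ≠ 0) ∧ IsRsopPart s ∧ (∀ i, ¬ p ∣ a i) ∧ IsUnit u ∧
          (∑ j : Fin p, cc j ^ p * G ^ (j : ℕ)) = RatFn.toFunctionField x₀ (u * ∏ i, s i ^ a i) ∧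
          (∀ i, s i ∉ stalkIdeal (vanishingIdeal C₀) x₀) ∧ (∀ i, IsUnit (γ i)) ∧
          (∀ i, π i ∈ stalkIdeal (vanishingIdeal C₀) x₀) ∧ (∀ i, s i = γ i * w ^ k i + π i) ∧ p ∣ ∑ i, k i * a i := by
    intro cc hcc m s hs a ha u hu hX
    rcases exists_pointChain_cleanPermissibleAt_or_uncharged_of_looseCleanForm hX₀ hC₀reg hx₀ hx₀C hdim₀ p G cc hcc w hw s hs a ha
        u hu hX with hexit | ⟨hsP, γ, π, k, hγ, hπ, hsk, hdiv⟩
    · exact Or.inl hexit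
    · exact Or.inr ⟨cc, m, s, a, u, γ, π, k, hcc, hs, ha, hu, hX, hsP, hγ, hπ, hsk, hdiv⟩
  rcases hform with ⟨d, m, hmd, t, a, u, hu, hspan, hdim, -, ha, hGX⟩ | ⟨u, hu, hGX, hup⟩ | ⟨s, c, hGX, hsc, hsc2⟩
  · -- form (1): the used components `s = t ∘ castLE`
    have hd : (maximalIdeal (X₀.presheaf.stalk x₀)).spanFinrank = d := by
      have h := IsRegularLocalRing.spanFinrank_maximalIdeal (R := X₀.presheaf.stalk x₀)
      rw [hdim] at h
      exact_mod_cast h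
    have hs : IsRsopPart (t ∘ Fin.castLE hmd) := isRsopPart_comp_of_rsop hd t hspan (Fin.castLE hmd) (Fin.castLE_injective hmd)
    exact wrap cc hcc (t ∘ Fin.castLE hmd) hs a ha u hu hGX
  · -- form (2): clean-permissible at `x₀` itself (chain of length `0`)
    refine Or.inl ⟨X₀, inferInstance, inferInstance, 𝟙 X₀, inferInstance, C₀, x₀, 0, IsPointChainAlong.nil C₀ x₀, rfl, hx₀, ?_⟩
    rw [RatFn.functionFieldMap_id, RingHom.id_apply]
    exact cleanPermissibleAt_of_unit p _ G _ cc hcc u hu hGX hup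
  · -- form (3): shift the representative; the new one is a regular parameter
    obtain ⟨cc', hcc', hX'⟩ := rep_shift_sub_pow p (RatFn.toFunctionField x₀) G cc hcc s c hGX
    have hr : IsRsopPart ![s - c ^ p] := isRsopPart_singleton_of_not_mem_sq hsc hsc2
    have hX'' : (∑ j : Fin p, cc' j ^ p * G ^ (j : ℕ)) =
        RatFn.toFunctionField x₀ (1 * ∏ i : Fin 1, (![s - c ^ p] : Fin 1 → _) i ^ (![1] : Fin 1 → ℕ) i) := by
      rw [hX']; simp
    exact wrap cc' hcc' ![s - c ^ p] hr ![1] (fun i => by fin_cases i; simpa using (Fact.out : p.Prime).one_lt.ne') 1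
      isUnit_one hX''

end Summit.ResolutionOfSingularities.ResolutionOfSingularities.Theorems.RadicialJung.CleanModels

end
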